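import Mathlib.Analysis.SpecialFunctions.Sqrt
import Mathlib.Topology.Algebra.Order.Field
import Literature.Analysis.FluidPDE.CompressibleEulerImplosionSonicSeries
import HarnessLib

/-!
# Buckmaster–Cao-Labora–Gómez-Serrano at `γ = 5/3`: the Taylor coefficients at `P_s` depend continuously on `r`

Topic `Literature/Analysis/FluidPDE`; namespace
`Literature.Analysis.FluidPDE.BuckmasterCaolaboraGomezserrano2025.Monatomic.SonicSeries`. Sequel of
`CompressibleEulerImplosionSonicSeries.lean` (the recursion (2.9)–(2.10) for the ordinary Taylor
coefficients `wₙ(r), zₙ(r)` of the smooth branch `(W^{(r)}, Z^{(r)})` at `P_s`), companion of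
`CompressibleEulerImplosion.lean` (named fact `BuckmasterCaolaboraGomezserrano2025_thm11_monatomic`,
THEOREM 1.1 of T. Buckmaster, G. Cao-Labora, J. Gómez-Serrano, *Smooth imploding solutions for 3D
compressible fluids*, Forum Math. Pi 13 (2025) e6, arXiv:2208.09445, at `γ = 5/3`).

Brick C2 part 1 of the discharge plan — the coefficient-level half of the continuity statement of
Proposition 2.3 ("`(W^{(r)}, Z^{(r)})` … is continuous with respect to `r`"): on the window
`(r₃, r₄)` every coefficient `r ↦ wₙ(r)`, `r ↦ zₙ(r)` is continuous (`continuousOn_w`,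
`continuousOn_z`), because the recursion only divides by `D_W(P_s) > 0` and by
`D_{Z,1}(n − k) ≠ 0`. Theorems only. [cite: BuckmasterCaolaboraGomezserrano2025, Prop. 2.3]
-/

noncomputable section

open Set Filter Topology Finset

namespace Literature.Analysis.FluidPDE

namespace BuckmasterCaolaboraGomezserrano2025

namespace Monatomic

namespace SonicSeries

/-! ### Continuity of the data at `P_s` -/

/-- [folklore] -/
theorem continuous_q : Continuous q := by
  unfold q disc
  exact Real.continuous_sqrt.comp (by fun_prop)

/-- [folklore] -/
theorem continuous_p : Continuous p := by
  unfold p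
  exact Real.continuous_sqrt.comp (by fun_prop)

/-- [folklore] -/
theorem continuous_W0 : Continuous W0 := by
  unfold W0; have := continuous_q; fun_prop

/-- [folklore] -/
theorem continuous_Z0 : Continuous Z0 := by
  unfold Z0; have := continuous_q; fun_prop

/-- [folklore] -/
theorem continuous_W1 : Continuous W1 := by
  unfold W1; have := continuous_q; fun_prop

/-- [folklore] -/
theorem continuous_Z1 : Continuous Z1 := by
  unfold Z1; have := continuous_q; have := continuous_p; fun_prop

/-! ### Continuity of all coefficients on the window `(r₃, r₄)` -/

/-- **Proposition 2.3 (continuity in `r`), coefficient level, at `γ = 5/3`**: for every `n`, the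
Taylor coefficients `r ↦ wₙ(r)` and `r ↦ zₙ(r)` of the smooth branch at `P_s` are continuous on
`(r₃, r₄)`. [cite: BuckmasterCaolaboraGomezserrano2025, Prop. 2.3] -/
theorem continuousOn_coef : ∀ N n : ℕ, n ≤ N →
    ContinuousOn (fun r => w r n) (Ioo r3 r4) ∧ ContinuousOn (fun r => z r n) (Ioo r3 r4) := by
  have hm := r3_r4_mem
  have hS : ∀ r ∈ Ioo r3 r4, r < rstar := fun r hr => hr.2.trans hm.2.2
  have hS2 : ∀ r ∈ Ioo r3 r4, r < 2 := fun r hr => by linarith [hS r hr, rstar_lt]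
  have h0w : ContinuousOn (fun r => w r 0) (Ioo r3 r4) := by
    simp only [w_zero]; exact continuous_W0.continuousOn
  have h0z : ContinuousOn (fun r => z r 0) (Ioo r3 r4) := by
    simp only [z_zero]; exact continuous_Z0.continuousOn
  have h1w : ContinuousOn (fun r => w r 1) (Ioo r3 r4) := by
    simp only [w_one]; exact continuous_W1.continuousOn
  have h1z : ContinuousOn (fun r => z r 1) (Ioo r3 r4) := by
    simp only [z_one]; exact continuous_Z1.continuousOn
  intro N
  induction N with
  | zero =>
    intro n hn
    obtain rfl : n = 0 := Nat.le_zero.mp hn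
    exact ⟨h0w, h0z⟩
  | succ N ih =>
    intro n hn
    rcases Nat.lt_or_eq_of_le hn with hlt | rfl
    · exact ih n (Nat.lt_succ_iff.mp hlt)
    rcases N with _ | n
    · exact ⟨h1w, h1z⟩
    -- the new index is `n + 2`; all indices `≤ n + 1` are continuous by `ih`
    have hw : ∀ i, i ≤ n + 1 → ContinuousOn (fun r => w r i) (Ioo r3 r4) := fun i hi => (ih i hi).1
    have hz : ∀ i, i ≤ n + 1 → ContinuousOn (fun r => z r i) (Ioo r3 r4) := fun i hi => (ih i hi).2
    -- sums
    have hcauchy : ∀ {u v : ℝ → ℕ → ℝ} (m : ℕ), m ≤ n + 1 →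
        (∀ i, i ≤ n + 1 → ContinuousOn (fun r => u r i) (Ioo r3 r4)) →
        (∀ i, i ≤ n + 1 → ContinuousOn (fun r => v r i) (Ioo r3 r4)) →
        ContinuousOn (fun r => cauchy (u r) (v r) m) (Ioo r3 r4) := by
      intro u v m hmn hu hv
      unfold cauchy
      refine continuousOn_finsetSum _ fun k hk => ?_
      rw [Finset.mem_range] at hk
      have h1 := hu k (by omega)
      have h2 := hv (m - k) (by omega)
      exact h1.mul h2
    have hrestW : ContinuousOn (fun r => restW r (w r) (z r) (n + 1)) (Ioo r3 r4) := by
      have c1 := hcauchy (u := fun r => w r) (v := fun r => w r) (n + 1) le_rfl hw hw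
      have c2 := hcauchy (u := fun r => w r) (v := fun r => z r) (n + 1) le_rfl hw hz
      have c3 := hcauchy (u := fun r => z r) (v := fun r => z r) (n + 1) le_rfl hz hz
      have h1 := hw (n + 1) le_rfl
      have hN : ContinuousOn (fun r => nWc r (w r) (z r) (n + 1)) (Ioo r3 r4) := by
        show ContinuousOn (fun r => -r * w r (n + 1) - 5 / 6 * cauchy (w r) (w r) (n + 1)
          - 1 / 3 * cauchy (w r) (z r) (n + 1) + 1 / 6 * cauchy (z r) (z r) (n + 1)) (Ioo r3 r4)
        exact (((continuousOn_id.neg.mul h1).sub (continuousOn_const.mul c1)).sub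
          (continuousOn_const.mul c2)).add (continuousOn_const.mul c3)
      unfold restW
      refine ContinuousOn.sub (continuousOn_finsetSum _ fun k hk => ?_) hN
      rw [Finset.mem_range] at hk
      simp only [dWc_succ]
      have h1 := hw (k + 1) (by omega)
      have h2 := hz (k + 1) (by omega)
      have h3 := hw (n + 1 - (k + 1) + 1) (by omega)
      exact ((((continuousOn_const.mul h1).add h2).div_const 3).mul continuousOn_const).mul h3
    -- continuity of `w_{n+2}`
    have hDW : ContinuousOn (fun r => DW (W0 r) (Z0 r)) (Ioo r3 r4) := by
      simp only [DW_Ps]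
      have := continuous_q
      exact Continuous.continuousOn (by fun_prop)
    have hw2 : ContinuousOn (fun r => w r (n + 2)) (Ioo r3 r4) := by
      have e : EqOn (fun r => w r (n + 2))
          (fun r => -restW r (w r) (z r) (n + 1) / (DW (W0 r) (Z0 r) * (((n + 1 : ℕ) : ℝ) + 1)))
          (Ioo r3 r4) := by
        intro r _
        show w r (n + 2) = _
        rw [w_succ_succ]
        unfold nextW
        rw [dWc_zero]
      refine ContinuousOn.congr ?_ e
      refine hrestW.neg.div (hDW.mul continuousOn_const) fun r hr => ?_
      exact mul_ne_zero (DW_Ps_pos (hS2 r hr)).ne' (by positivity)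
    have hw' : ∀ i, i ≤ n + 2 → ContinuousOn (fun r => w r i) (Ioo r3 r4) := by
      intro i hi
      rcases Nat.lt_or_eq_of_le hi with h | rfl
      · exact hw i (by omega)
      · exact hw2
    -- continuity of `z_{n+2}`
    have hcoefW : ContinuousOn (fun r => coefW (w r) (z r)) (Ioo r3 r4) := by
      show ContinuousOn (fun r => z r 1 / 3 - NZ_W (w r 0) (z r 0)) (Ioo r3 r4)
      unfold NZ_W
      exact (h1z.div_const 3).sub ((h0w.sub h0z).div_const 3)
    have hslope : ContinuousOn (fun r => slopeZ r (w r) (z r) (n + 2)) (Ioo r3 r4) := by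
      show ContinuousOn (fun r => dZc (w r) (z r) 1 * ((n + 2 : ℕ) : ℝ) + 2 / 3 * z r 1
        - NZ_Z r (w r 0) (z r 0)) (Ioo r3 r4)
      simp only [dZc_one]
      unfold NZ_Z
      exact ((((h1w.add (continuousOn_const.mul h1z)).div_const 3).mul continuousOn_const).add
        (continuousOn_const.mul h1z)).sub
        ((continuousOn_id.add (h0w.div_const 3)).add ((continuousOn_const.mul h0z).div_const 3)).neg
    have hrestZ : ContinuousOn (fun r => restZ (w r) (z r) n) (Ioo r3 r4) := by
      unfold restZ
      refine ((ContinuousOn.add (ContinuousOn.add (continuousOn_finsetSum _ fun k hk => ?_)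
        (continuousOn_const.mul (continuousOn_finsetSum _ fun k hk => ?_)))
        (continuousOn_const.mul (continuousOn_finsetSum _ fun k hk => ?_))).sub
        (continuousOn_const.mul (continuousOn_finsetSum _ fun k hk => ?_)))
      · rw [Finset.mem_range] at hk
        simp only [dZc_succ]
        have h1 := hw (k + 2) (by omega)
        have h2 := hz (k + 2) (by omega)
        have h3 := hz (n - k + 1) (by omega)
        exact ((((h1.add (continuousOn_const.mul h2)).div_const 3).mul continuousOn_const)).mul h3
      · rw [Finset.mem_range] at hk
        exact (hw (k + 1) (by omega)).mul (hz (n + 1 - k) (by omega))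
      · rw [Finset.mem_range] at hk
        exact (hz (k + 1) (by omega)).mul (hz (n + 1 - k) (by omega))
      · rw [Finset.mem_range] at hk
        exact (hw (k + 1) (by omega)).mul (hw (n + 1 - k) (by omega))
    have hz2 : ContinuousOn (fun r => z r (n + 2)) (Ioo r3 r4) := by
      have e : EqOn (fun r => z r (n + 2))
          (fun r => -(coefW (w r) (z r) * w r (n + 2) + restZ (w r) (z r) n)
            / slopeZ r (w r) (z r) (n + 2)) (Ioo r3 r4) := by
        intro r _
        show z r (n + 2) = _
        rw [z_succ_succ]
        rfl
      refine ContinuousOn.congr ?_ e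
      exact ((hcoefW.mul hw2).add hrestZ).neg.div hslope fun r hr => slopeZ_ne hr.1 hr.2 (n + 2)
    exact ⟨hw2, hz2⟩

/-- `r ↦ wₙ(r)` is continuous on `(r₃, r₄)`. [cite: BuckmasterCaolaboraGomezserrano2025, Prop. 2.3] -/
theorem continuousOn_w (n : ℕ) : ContinuousOn (fun r => w r n) (Ioo r3 r4) :=
  (continuousOn_coef n n le_rfl).1

/-- `r ↦ zₙ(r)` is continuous on `(r₃, r₄)`. [cite: BuckmasterCaolaboraGomezserrano2025, Prop. 2.3] -/
theorem continuousOn_z (n : ℕ) : ContinuousOn (fun r => z r n) (Ioo r3 r4) :=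
  (continuousOn_coef n n le_rfl).2

end SonicSeries

end Monatomic

end BuckmasterCaolaboraGomezserrano2025

end Literature.Analysis.FluidPDE
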